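import Summits.BirchSwinnertonDyer.BirchSwinnertonDyer.Theorems.SignedLowerHalvesSmallImageLowerHalfBothSignsRttTierOneClosure
import Summits.BirchSwinnertonDyer.BirchSwinnertonDyer.Theorems.SignedLowerHalvesSmallImageLowerHalfBothSignsRttTierUnitClosure
import Summits.BirchSwinnertonDyer.Rank1Residual.Supersingular.MazurTateCertificates
import Summits.BirchSwinnertonDyer.Rank1Residual.X11a.MuLambdaSplit
import Summits.BirchSwinnertonDyer.BirchSwinnertonDyer.Theorems.SignedLowerHalvesKobayashiLowerHalfLargeImageLambdaTwoStratum
import HarnessLib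

/-!
# Route `SignedLowerHalves`, crux L `SmallImageLowerHalfBothSigns` (item stmt-BirchSwinnertonDyer-23599), line `rtt_w3` v4/v5:
# the ONE-SIGN FLOOR AT A PAIR from ONE displayed MAZUR–TATE ROW — tier T1 / T1u closures with the floor binder `hfloor`
# replaced by a finite certificate `(n, θ_n ≢ 0 (mod p), λ(θ_n) = deg ω_n^∓ + l)`

Width seat `bsd-line-slh-p3-w3` g14 under LEAD `cruxlead-stmt-BirchSwinnertonDyer-23599` g3 (cell `bsd-ssimc`); helper
`--supports stmt-BirchSwinnertonDyer-23599`; THEOREMS ONLY — no definition, no named fact, no `sorry`; PER PAIR machinery (the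
class-wide crux and its conjecture-grade stub `stub_muOneSign_ns_ge5` stay open); BSD is proved for no curve by this.

WHY. Off `p = 3` every per-pair record of line `rtt_w3` (tier T1 `…RttTierOneRecords16–21`, p749742 … p749857, 22 pairs at `p = 5`;
tier T1u `…_of_unitCurvePartner_of_oneSignFloor`) carries the displayed binder
`hfloor : ∀ f, IsNewformOf W f → ∃ ε₀ L₀, IsSignedPAdicLFunction f p ε₀ L₀ ∧ HasUnitContent L₀` — the one-sign `μ`-floor AT THE PAIR,
an EXISTENTIAL statement about the signed `p`-adic `L`-function (= crux M `SmallImageMuZeroOneSign` specialised). The cell's b2b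
lane long ago reduced such statements to a FINITE certificate (file `Rank1Residual/Supersingular/MazurTateCertificates`, p214879 ff.,
IMAGE-FREE: hypotheses `p ≠ 2`, `IsNewformOf`, good, `a_p = 0`): if at ONE layer `n` of the parity of `ε₀` the Mazur–Tate element
`θ_n(f)` is `p`-integral (`= Θ ∈ Λ`), `Θ ≢ 0 (mod p)` (`μ(Θ) = 0`) and `λ(Θ) = deg ω_n^{−ε₀} + l`, then `(μ, λ)(L^{ε₀}_p) = (0, l)`
(`lam_signed_one/neg_one_eq_of_mazurTate'`, Pollack 2003 Prop. 6.9/6.10/6.18; `λ(θ_n) < pⁿ` is automatic). `μ = 0` of the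
non-zero `L^{ε₀}_p` (Pollack Cor. 5.11, carried by `IsPollackPair`) is unit content (`X11a.hasUnitContent_of_mu_eq_zero`). So the
floor binder of every such record can be replaced by ONE displayed row `(n, μ(θ_n) = 0, λ(θ_n))` — the same currency as the ~70
congruence-road records of the large-image crux (`…LargeImageCongruenceRecordsNN`: «E's displayed two-engine row `hΘ, hΘ0, hμ, hlam`»)
— and such rows EXIST for all 36 small-image pairs at `p ≥ 5` (disprover kit j335262, `gvkan2/LAYERS.tsv`, evidence #53–#56 on the item:
`μ(θ_n) = 0` at the top layer of BOTH parities, 93/93 pairs).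

* §1 `mu_lam_kobayashiL_of_mazurTateRow`, `hasUnitContent_kobayashiL_of_mazurTateRow` (non-vanishing: the large-image cell's
  `LargeImageLambdaTwoStratum.kobayashiL_ne_zero`, Pollack Cor. 5.11) —
  one row of parity `ε₀` ⇒ `(μ, λ)(L^{ε₀}_p) = (0, l)` and unit content, for the `L^{ε₀}` of ANY Pollack pair of the newform.
* §2 `oneSignFloor_of_mazurTateRowOdd` / `…Even` — the floor in the shape the one-sided core consumes
  (`∀ f, IsNewformOf W f → ∀ L⁺ L⁻, IsPollackPair f p L⁺ L⁻ → HasUnitContent (kobayashiL ε₀ L⁺ L⁻)`), from a row displayed for every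
  newform `f` of `W` at an ODD layer (`ε₀ = −1`, `deg ω_n^+`) / an EVEN layer (`ε₀ = +1`, `deg ω_n^−`). No existence theorem for
  `L^±_p` is used (the Pollack pair is a binder of the consumer), so NO new named fact enters.
* §3 ★ `forall_kobayashiLowerDivisibility_of_cmCurvePartner_of_mazurTateRowOdd` (tier T1, any odd `p`) and
  ★ `forall_kobayashiLowerDivisibility_of_unitCurvePartner_of_mazurTateRowOdd` (tier T1u): the LEAD's / g13's closures
  (`…_of_oneSignFloor`, p748602 / p751654) with `hfloor` := §2. Inputs BY NAME unchanged otherwise (12 resp. 11 published facts).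

References: [Pollack2003] Prop. 6.9, 6.10, 6.18, Cor. 5.11, Conj. 6.3; [Kobayashi2003] Conjecture (p. 2), Thm. 1.2, 4.1, 7.4;
[PollackRubin2004] Theorem (p. 448); [BDKim2009] Cor. 2.13; [Vatsal1999] (1.6), (1.13); [GreenbergVatsal2000] p. 2 (2), §3 Rem. 3.4.
-/

set_option autoImplicit false
-- D-0017: single-problem summit, the namespace repeats the problem name by design.
set_option linter.dupNamespace false
noncomputable section

open scoped Classical MatrixGroups ModularForm BigOperators

open CongruenceSubgroup WeierstrassCurve Field Polynomial NumberField IsDedekindDomain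
  Literature.NumberTheory.EllipticCurves Literature.NumberTheory.EllipticCurves.ModularForms
  Literature.NumberTheory.EllipticCurves.Rank1Residual
  Literature.NumberTheory.EllipticCurves.Kobayashi2003
  Literature.NumberTheory.EllipticCurves.GreenbergVatsal2000 ZpExtension
  Literature.NumberTheory.IwasawaTheory Rat.HeightOneSpectrum
  Summit.BirchSwinnertonDyer.Rank1Residual.Supersingular
  Summit.BirchSwinnertonDyer.Rank1Residual.X1.MuLambda
  Summit.BirchSwinnertonDyer.BirchSwinnertonDyer.Theorems.SmallImageLambdaLowerThreeNsThetaTransport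

namespace Summit.BirchSwinnertonDyer.BirchSwinnertonDyer.Theorems.SmallImageRttOneSided

/-! ## §1 One Mazur–Tate row ⇒ `(μ, λ)(L^{ε₀}_p) = (0, l)` and unit content -/

section Row

variable {W : WeierstrassCurve ℚ} [W.IsElliptic] [W.IsGloballyMinimal] {p : ℕ} [Fact p.Prime]

/-- **`(μ, λ)(L^{ε₀}_p) = (0, l)` from ONE Mazur–Tate row of the parity of `ε₀`.** `W/ℚ` good at the odd `p` with `a_p = 0`, `f` a
newform of `W` (any level), `(L⁺, L⁻)` a Pollack pair of `f`; if at a layer `n` with `Even n ↔ ε₀ = 1` the Mazur–Tate element `θ_n(f)`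
equals `Θ ∈ Λ` (integrality), `Θ ≠ 0`, `μ(Θ) = 0` and `λ(Θ) = deg ω_n^{−ε₀} + l` (`ω_n^{−} = cyclotomicOmegaMinus` for `ε₀ = 1`,
`ω_n^{+} = cyclotomicOmegaPlus` for `ε₀ = −1`), then `μ(L^{ε₀}) = 0` and `λ(L^{ε₀}) = l` for `L^{ε₀} = kobayashiL ε₀ L⁺ L⁻`. Both signs of the
b2b certificate theorems `lam_signed_one/neg_one_eq_of_mazurTate'` in one statement. IMAGE-FREE; no named fact.
[cite: Pollack2003, Prop. 6.9, Prop. 6.10 and Prop. 6.18] -/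
theorem mu_lam_kobayashiL_of_mazurTateRow (hp2 : p ≠ 2) {N : ℕ} [NeZero N] {f : CuspForm (Gamma0 N) 2}
    (hf : IsNewformOf W f) (hgood : W.HasGoodReductionAtPrime p) (hap : W.frobeniusTrace p = 0)
    (ε₀ : ℤˣ) {n : ℕ} (hn : Even n ↔ ε₀ = 1) {Θ : IwasawaAlgebra p}
    (hΘ : iwasawaToPowerSeries p Θ = ((mazurTateElement f p n).map (algebraMap ℚ ℚ_[p]) : PowerSeries ℚ_[p]))
    (hΘ0 : Θ ≠ 0) (hμ : mu Θ = 0) {l : ℕ}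
    (hlam : lam Θ = (if ε₀ = 1 then cyclotomicOmegaMinus p n else cyclotomicOmegaPlus p n).natDegree + l)
    {Lplus Lminus : IwasawaAlgebra p} (hPP : IsPollackPair f p Lplus Lminus) :
    mu (kobayashiL ε₀ Lplus Lminus) = 0 ∧ lam (kobayashiL ε₀ Lplus Lminus) = l := by
  rcases Int.units_eq_one_or ε₀ with h1 | h1
  · subst h1
    rw [if_pos rfl] at hlam
    exact lam_signed_one_eq_of_mazurTate' hp2 hf hgood hap (hPP.isSignedPAdicLFunction_kobayashiL 1) (hn.mpr rfl)
      hΘ hΘ0 hμ hlam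
  · subst h1
    have hne : (-1 : ℤˣ) ≠ 1 := by decide
    rw [if_neg hne] at hlam
    have hodd : Odd n := Nat.not_even_iff_odd.mp (fun h ↦ hne (hn.mp h))
    exact lam_signed_neg_one_eq_of_mazurTate' hp2 hf hgood hap (hPP.isSignedPAdicLFunction_kobayashiL (-1)) hodd
      hΘ hΘ0 hμ hlam

/-- **Unit content of `L^{ε₀}_p` from ONE Mazur–Tate row of the parity of `ε₀`** (§1 + `μ = 0 ⇒` unit content for a non-zero
element of `Λ`, `X11a.hasUnitContent_of_mu_eq_zero`). This is the one-sign floor of line `rtt_w3` AT THE PAIR, for the `L^{ε₀}` of the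
given Pollack pair. IMAGE-FREE; no named fact. [cite: Pollack2003, Prop. 6.18, Cor. 5.11 and Conj. 6.3]
[cite: GreenbergVatsal2000, p. 2, (2)] -/
theorem hasUnitContent_kobayashiL_of_mazurTateRow (hp2 : p ≠ 2) {N : ℕ} [NeZero N] {f : CuspForm (Gamma0 N) 2}
    (hf : IsNewformOf W f) (hgood : W.HasGoodReductionAtPrime p) (hap : W.frobeniusTrace p = 0)
    (ε₀ : ℤˣ) {n : ℕ} (hn : Even n ↔ ε₀ = 1) {Θ : IwasawaAlgebra p}
    (hΘ : iwasawaToPowerSeries p Θ = ((mazurTateElement f p n).map (algebraMap ℚ ℚ_[p]) : PowerSeries ℚ_[p]))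
    (hΘ0 : Θ ≠ 0) (hμ : mu Θ = 0) {l : ℕ}
    (hlam : lam Θ = (if ε₀ = 1 then cyclotomicOmegaMinus p n else cyclotomicOmegaPlus p n).natDegree + l)
    {Lplus Lminus : IwasawaAlgebra p} (hPP : IsPollackPair f p Lplus Lminus) :
    HasUnitContent (kobayashiL ε₀ Lplus Lminus) :=
  Summit.BirchSwinnertonDyer.Rank1Residual.X11a.hasUnitContent_of_mu_eq_zero (LargeImageLambdaTwoStratum.kobayashiL_ne_zero p hPP ε₀)
    (mu_lam_kobayashiL_of_mazurTateRow hp2 hf hgood hap ε₀ hn hΘ hΘ0 hμ hlam hPP).1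

end Row

/-! ## §2 The floor in the one-sided core's shape, from a row displayed for every newform of `W` -/

section Floor

variable (W : WeierstrassCurve ℚ) [W.IsElliptic] [W.IsGloballyMinimal] (p : ℕ) [Fact p.Prime]

/-- **One-sign floor at `ε₀ = −1` from an ODD Mazur–Tate row.** If for every newform `f` of `W` the Mazur–Tate element `θ_n(f)` at the
odd layer `n` is `= Θ ∈ Λ` with `Θ ≠ 0`, `μ(Θ) = 0`, `λ(Θ) = deg ω_n^+ + l` (displayed data of the pair; `deg ω_n^+ = deg cyclotomicOmegaPlus p n`),
then for every newform `f` of `W` and every Pollack pair `(L⁺, L⁻)` of `f`, `L^{−}_p = kobayashiL (−1) L⁺ L⁻` has unit content — the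
binder `hfl` of `kobayashiMainConjecture_of_lamTransport_le` at `ε₀ = −1`. IMAGE-FREE; no named fact.
[cite: Pollack2003, Prop. 6.18 and Conj. 6.3] -/
theorem oneSignFloor_of_mazurTateRowOdd (hp2 : p ≠ 2) (hgood : W.HasGoodReductionAtPrime p) (hap : W.frobeniusTrace p = 0)
    {n : ℕ} (hn : Odd n) {l : ℕ}
    (hrow : ∀ [NeZero (W.conductorNorm ℤ)] (f : CuspForm (Gamma0 (W.conductorNorm ℤ)) 2), IsNewformOf W f →
      ∃ Θ : IwasawaAlgebra p, iwasawaToPowerSeries p Θ =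
          ((mazurTateElement f p n).map (algebraMap ℚ ℚ_[p]) : PowerSeries ℚ_[p]) ∧
        Θ ≠ 0 ∧ mu Θ = 0 ∧ lam Θ = (cyclotomicOmegaPlus p n).natDegree + l) :
    ∀ [NeZero (W.conductorNorm ℤ)] (f : CuspForm (Gamma0 (W.conductorNorm ℤ)) 2), IsNewformOf W f →
      ∀ Lplus Lminus : IwasawaAlgebra p, IsPollackPair f p Lplus Lminus →
        HasUnitContent (kobayashiL (-1) Lplus Lminus) := by
  intro _ f hf Lplus Lminus hPP
  obtain ⟨Θ, hΘ, hΘ0, hμ, hlam⟩ := hrow f hf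
  have hne : (-1 : ℤˣ) ≠ 1 := by decide
  exact hasUnitContent_kobayashiL_of_mazurTateRow hp2 hf hgood hap (-1)
    ⟨fun h ↦ absurd hn (Nat.not_odd_iff_even.mpr h), fun h ↦ absurd h hne⟩ hΘ hΘ0 hμ (by rwa [if_neg hne]) hPP

/-- **One-sign floor at `ε₀ = +1` from an EVEN Mazur–Tate row** (`deg ω_n^− = deg cyclotomicOmegaMinus p n`): for every newform `f`
of `W` and every Pollack pair, `L^{+}_p = kobayashiL 1 L⁺ L⁻` has unit content. IMAGE-FREE; no named fact.
[cite: Pollack2003, Prop. 6.18 and Conj. 6.3] -/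
theorem oneSignFloor_of_mazurTateRowEven (hp2 : p ≠ 2) (hgood : W.HasGoodReductionAtPrime p) (hap : W.frobeniusTrace p = 0)
    {n : ℕ} (hn : Even n) {l : ℕ}
    (hrow : ∀ [NeZero (W.conductorNorm ℤ)] (f : CuspForm (Gamma0 (W.conductorNorm ℤ)) 2), IsNewformOf W f →
      ∃ Θ : IwasawaAlgebra p, iwasawaToPowerSeries p Θ =
          ((mazurTateElement f p n).map (algebraMap ℚ ℚ_[p]) : PowerSeries ℚ_[p]) ∧
        Θ ≠ 0 ∧ mu Θ = 0 ∧ lam Θ = (cyclotomicOmegaMinus p n).natDegree + l) :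
    ∀ [NeZero (W.conductorNorm ℤ)] (f : CuspForm (Gamma0 (W.conductorNorm ℤ)) 2), IsNewformOf W f →
      ∀ Lplus Lminus : IwasawaAlgebra p, IsPollackPair f p Lplus Lminus →
        HasUnitContent (kobayashiL 1 Lplus Lminus) := by
  intro _ f hf Lplus Lminus hPP
  obtain ⟨Θ, hΘ, hΘ0, hμ, hlam⟩ := hrow f hf
  exact hasUnitContent_kobayashiL_of_mazurTateRow hp2 hf hgood hap 1 ⟨fun _ ↦ rfl, fun _ ↦ hn⟩ hΘ hΘ0 hμ
    (by rwa [if_pos rfl]) hPP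

end Floor

/-! ## §3 Tier T1 / T1u closures: crux L's body at the pair from print + ONE odd Mazur–Tate row -/

section Closures

variable (W A : WeierstrassCurve ℚ) [W.IsElliptic] [W.IsGloballyMinimal] [A.IsElliptic] [A.IsGloballyMinimal]
  (p : ℕ) [Fact p.Prime]

/-- ★ **TIER T1 AT ANY ODD `p` MODULO PRINT AND ONE ODD MAZUR–TATE ROW OF THE PAIR**: crux L's body `∀ ε, KobayashiLowerDivisibility W p ε`
at a small-image supersingular X7 pair (`p` odd, `ClassX7 W p`, `W` non-CM, `a_p = 0`, `¬ Surj W p`) with a CM elliptic-curve partner `A`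
(`A.HasCM`, `GoodSS A p`, `a_p(A) = 0`, `W[p] ≃ A[p]` `Γ_ℚ`-equivariantly), from the TWELVE published named facts of the v4/v5 cite stub
(`hJ h12 h41 h5 h3 hD hC hS hmod hKim hPR hV`) and, instead of the existential floor `hfloor` of
`forall_kobayashiLowerDivisibility_of_cmCurvePartner_of_oneSignFloor` (p748602), ONE displayed row at an ODD layer `n`:
`θ_n(f) = Θ ∈ Λ`, `Θ ≠ 0`, `μ(Θ) = 0`, `λ(Θ) = deg ω_n^+ + l` for every newform `f` of `W`. Chain: §2 (floor at `ε₀ = −1`) ⇒ the LEAD's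
one-sided core `kobayashiMainConjecture_of_lamTransport_le` fed by `lamTransport_le_of_cmCurvePartner` ⇒ `KobayashiMainConjecture W p (−1)`
⇒ both signs of crux L's body by `SignDefect.X7.exists_kobayashiLowerDivisibility_iff_forall` (Kobayashi (7.21), `hJ`). Per pair;
CONDITIONAL on print; the class-wide crux / BSD are NOT proved by this.
[cite: Kobayashi2003, Conjecture (p. 2), Thm. 7.4 (p. 13)] [cite: Pollack2003, Prop. 6.18, Conj. 6.3] [cite: PollackRubin2004, Theorem (p. 448)]
[cite: BDKim2009, Cor. 2.13] [cite: Vatsal1999, Thm. (1.6), (1.13)] -/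
theorem forall_kobayashiLowerDivisibility_of_cmCurvePartner_of_mazurTateRowOdd
    (hJ : thm62_63_73_signedColemanKato_zetaJoint) (h12 : thm12_signedSelmerDual_finite_torsion)
    (h41 : thm41_signedCharIdeal_divisibility)
    (h5 : realPeriodRat_eq_unit_mul_plusPeriod) (h3 : realPeriodRat_eq_unit_mul_plusPeriod_three)
    (hD : Hida2000_thm326_exists_galoisRep) (hC : Carayol1986_artinConductorExponent)
    (hS : ∀ (V : WeierstrassCurve ℚ) (ℓ : ℕ) [Fact ℓ.Prime],
      V.swanConductorAt_rationalTate_eq_wildConductorExponent_of_ringChar_eq_two ℓ)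
    (hmod : exists_isNewformOf)
    (hKim : BDKim2009.cor213_signedLambda_add_sum_delta_eq_of_torsionIso)
    (hPR : PollackRubin2004.mainTheorem_signedCharIdeal_eq_of_cm) (hV : vatsal1999_plusSymbol_congruence)
    (hp : p ≠ 2) (hX : ClassX7 W p) (hcm : ¬ W.HasCM) (hap : W.frobeniusTrace p = 0) (hs : ¬ Surj W p)
    (hcmA : A.HasCM) (hssA : GoodSS A p) (hapA : A.frobeniusTrace p = 0)
    (he : ∃ e : geomTorsion W (p : ℤ) ≃+ geomTorsion A (p : ℤ),
      ∀ (σ : absoluteGaloisGroup ℚ) (P : geomTorsion W (p : ℤ)), e (σ • P) = σ • e P)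
    {n : ℕ} (hn : Odd n) {l : ℕ}
    (hrow : ∀ [NeZero (W.conductorNorm ℤ)] (f : CuspForm (Gamma0 (W.conductorNorm ℤ)) 2), IsNewformOf W f →
      ∃ Θ : IwasawaAlgebra p, iwasawaToPowerSeries p Θ =
          ((mazurTateElement f p n).map (algebraMap ℚ ℚ_[p]) : PowerSeries ℚ_[p]) ∧
        Θ ≠ 0 ∧ mu Θ = 0 ∧ lam Θ = (cyclotomicOmegaPlus p n).natDegree + l) :
    ∀ ε : ℤˣ, KobayashiLowerDivisibility W p ε := by
  have hfl : ∀ [NeZero (W.conductorNorm ℤ)] (f : CuspForm (Gamma0 (W.conductorNorm ℤ)) 2), IsNewformOf W f →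
      ∀ Lplus Lminus : IwasawaAlgebra p, IsPollackPair f p Lplus Lminus →
        HasUnitContent (kobayashiL (-1) Lplus Lminus) :=
    fun f hf Lplus Lminus hPP ↦ oneSignFloor_of_mazurTateRowOdd W p hp hX.1.1 hap hn hrow f hf Lplus Lminus hPP
  have hMC : KobayashiMainConjecture W p (-1) :=
    kobayashiMainConjecture_of_lamTransport_le W p hp (thm62_63_73_signedColemanKato_zeta_of_joint hJ) h12 h41 h5 h3
      hX.1.1 hap hs (-1) (fun f hf Lplus Lminus hPP ↦ hfl f hf Lplus Lminus hPP)
      (fun κ γ hκ hγ hγ' _ f hf ϖ hϖ Lplus Lminus hPP D _ hXt hμ G m hG ↦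
        lamTransport_le_of_cmCurvePartner W A p h12 h5 h3 hD hC hS hmod hKim hPR hV hp hX hcm hap hs hcmA hssA hapA he (-1)
          κ γ hκ hγ hγ' f hf ϖ hϖ Lplus Lminus hPP (hfl f hf Lplus Lminus hPP) D hXt hμ G m hG)
  exact fun ε ↦ (SignDefect.X7.exists_kobayashiLowerDivisibility_iff_forall W p h12 h5 h3 hJ hp hX hap).mp
    ⟨-1, kobayashiLowerDivisibility_of_mainConjecture hMC⟩ ε

/-- ★ **TIER T1u AT ANY ODD `p` MODULO PRINT AND ONE ODD MAZUR–TATE ROW OF THE PAIR**: crux L's body at a small-image supersingular X7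
pair with a UNIT CURVE PARTNER `A` (good at `p`, `a_p(A) = 0`, `W[p] ≃ A[p]` equivariantly, `L(A,1)/Ω_A = t` a non-zero `p`-adic unit), from
the ELEVEN published named facts of g13's `forall_kobayashiLowerDivisibility_of_unitCurvePartner_of_oneSignFloor` (p751654; no Pollack–Rubin)
with its floor binder `hfloor` replaced by ONE displayed odd row (`θ_n(f) = Θ ∈ Λ`, `Θ ≠ 0`, `μ(Θ) = 0`, `λ(Θ) = deg ω_n^+ + l`).
Per pair; CONDITIONAL; closes nothing class-wide. [cite: Kobayashi2003, Conjecture (p. 2), (3.6), Thm. 7.4 (p. 13)]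
[cite: Pollack2003, Prop. 6.18, Conj. 6.3] [cite: BDKim2009, Cor. 2.13] [cite: Vatsal1999, Thm. (1.6), (1.13)] -/
theorem forall_kobayashiLowerDivisibility_of_unitCurvePartner_of_mazurTateRowOdd
    (hJ : thm62_63_73_signedColemanKato_zetaJoint) (h12 : thm12_signedSelmerDual_finite_torsion)
    (h41 : thm41_signedCharIdeal_divisibility)
    (h5 : realPeriodRat_eq_unit_mul_plusPeriod) (h3 : realPeriodRat_eq_unit_mul_plusPeriod_three)
    (hD : Hida2000_thm326_exists_galoisRep) (hC : Carayol1986_artinConductorExponent)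
    (hS : ∀ (V : WeierstrassCurve ℚ) (ℓ : ℕ) [Fact ℓ.Prime],
      V.swanConductorAt_rationalTate_eq_wildConductorExponent_of_ringChar_eq_two ℓ)
    (hmod : exists_isNewformOf)
    (hKim : BDKim2009.cor213_signedLambda_add_sum_delta_eq_of_torsionIso) (hV : vatsal1999_plusSymbol_congruence)
    (hp : p ≠ 2) (hX : ClassX7 W p) (hap : W.frobeniusTrace p = 0) (hs : ¬ Surj W p)
    (hgoodA : A.HasGoodReductionAtPrime p) (hapA : A.frobeniusTrace p = 0)
    (he : ∃ e : geomTorsion W (p : ℤ) ≃+ geomTorsion A (p : ℤ),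
      ∀ (σ : absoluteGaloisGroup ℚ) (P : geomTorsion W (p : ℤ)), e (σ • P) = σ • e P)
    {t : ℚ} (ht : A.entireLFunction 1 / (A.realPeriodRat : ℂ) = ((t : ℚ) : ℂ)) (ht0 : t ≠ 0)
    (hvt : padicValRat p t = 0)
    {n : ℕ} (hn : Odd n) {l : ℕ}
    (hrow : ∀ [NeZero (W.conductorNorm ℤ)] (f : CuspForm (Gamma0 (W.conductorNorm ℤ)) 2), IsNewformOf W f →
      ∃ Θ : IwasawaAlgebra p, iwasawaToPowerSeries p Θ =
          ((mazurTateElement f p n).map (algebraMap ℚ ℚ_[p]) : PowerSeries ℚ_[p]) ∧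
        Θ ≠ 0 ∧ mu Θ = 0 ∧ lam Θ = (cyclotomicOmegaPlus p n).natDegree + l) :
    ∀ ε : ℤˣ, KobayashiLowerDivisibility W p ε := by
  have hfl : ∀ [NeZero (W.conductorNorm ℤ)] (f : CuspForm (Gamma0 (W.conductorNorm ℤ)) 2), IsNewformOf W f →
      ∀ Lplus Lminus : IwasawaAlgebra p, IsPollackPair f p Lplus Lminus →
        HasUnitContent (kobayashiL (-1) Lplus Lminus) :=
    fun f hf Lplus Lminus hPP ↦ oneSignFloor_of_mazurTateRowOdd W p hp hX.1.1 hap hn hrow f hf Lplus Lminus hPP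
  have hMC : KobayashiMainConjecture W p (-1) :=
    kobayashiMainConjecture_of_lamTransport_le W p hp (thm62_63_73_signedColemanKato_zeta_of_joint hJ) h12 h41 h5 h3
      hX.1.1 hap hs (-1) (fun f hf Lplus Lminus hPP ↦ hfl f hf Lplus Lminus hPP)
      (fun κ γ hκ hγ hγ' _ f hf ϖ hϖ Lplus Lminus hPP D _ hXt hμ G m hG ↦
        lamTransport_le_of_unitCurvePartner W A p h12 h5 h3 hD hC hS hmod hKim hV hp hX hap hgoodA hapA he ht ht0 hvt (-1)
          κ γ hκ hγ hγ' f hf ϖ hϖ Lplus Lminus hPP (hfl f hf Lplus Lminus hPP) D hXt hμ G m hG)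
  exact fun ε ↦ (SignDefect.X7.exists_kobayashiLowerDivisibility_iff_forall W p h12 h5 h3 hJ hp hX hap).mp
    ⟨-1, kobayashiLowerDivisibility_of_mainConjecture hMC⟩ ε

end Closures

end Summit.BirchSwinnertonDyer.BirchSwinnertonDyer.Theorems.SmallImageRttOneSided

end
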